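import Literature.AlgebraicGeometry.Motives.HodgeThetaSubalgebraUnitaryLeviKernel
import HarnessLib

/-!
# A rank-one raising operator forces `𝔊 = End(W)` when `dim P ≠ dim Q`
# (Ribet 1983 Thm. 3, Lie step — the «double Levi» route, part II)

Family `hodge`, layer `Literature/AlgebraicGeometry/Motives` (pure linear algebra over `ℂ`; no geometry). Research
context: cell `pub-hodge-ring2` (HONEST FRAMING: research route conditional on HC_CM; not a corollary; Q11.4-sentence-2
already refuted in dim ≥ 3), Literature lane gen 85, programme R70. UNCONDITIONAL; theorems only, no definition, no
named fact (D-0026), no `sorry`. Sequel of `HodgeThetaSubalgebraUnitaryLeviKernel`.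

THE THEOREM (`UnitaryRankOneRaise.eq_top_of_rankOne_raise`). In the setting of the unitary cores (`𝔊 ⊆ End(W)`
bracket-closed, irreducible, `Θ ∈ 𝔊` an involution with eigenspaces `P`, `Q` of dimensions `a ≠ b`, both `≥ 3`, Hermitian
data, `𝔊` adjoint-closed), if `𝔊` contains a raising operator `B₁` of RANK ONE then `𝔊 = End(W)`.

PROOF (no classification, no core hypothesis — the two Levi types `(1 | b − 1)` and `(a − 1 | 1)` of the involution
`ι = Θ − 2D₁` are `(m, 1)`-cores, in the tree as `UnitaryThreeCoprime.eq_top_of_finrank_eq_one`). By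
`UnitaryThreeCoprime.levi_instance` both Levi algebras are full: `L⁻ = End(U⁻)` (`dim U⁻ = b`), `L⁺ = End(U⁺)`
(`dim U⁺ = a`). Goursat's identity (`UnitaryLeviKernel.exists_kernel_levi`) reads `dim I⁻ + a² = dim I⁺ + b²` for the
Levi kernel ideals, which are `ad`-stable (`UnitaryLeviKernel.kernel_adStable`); the larger side has `dim I ≥ 3`, hence
(`UnitaryAdStable.mem_of_trace_eq_zero`) contains `𝔰𝔩`, hence has `dim ≥ n² − 1`, and then the smaller side has
`dim ≥ 2` as well: BOTH `I⁻ ⊇ 𝔰𝔩(U⁻)` and `I⁺ ⊇ 𝔰𝔩(U⁺)` (§1 `UnitaryRankOneRaise.traceless_sub_of_two_le`). Now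
`Z₀ = a·Θ − (a − 2)·ι ∈ 𝔊` commutes with `ι` and has `tr(Z₀|_{U⁺}) = a(a − 2) − (a − 2)a = 0`,
`tr(Z₀|_{U⁻}) = a(2 − b) + (a − 2)b = 2(a − b) ≠ 0` (§1 `UnitaryRankOneRaise.trace_restrict_theta`:
`tr Θ|_U = 2·dim(P ∩ U) − dim U`); so `Z₀|_{U⁺} ∈ I⁺`, i.e. `Z₀|_{U⁺} = K|_{U⁺}` with `K ∈ 𝔊` killing `U⁻`, and then
`Z₀ − K ∈ 𝔊` kills `U⁺` and restricts to `Z₀|_{U⁻}` on `U⁻`: an element of `I⁻` of non-zero trace. By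
`UnitaryAdStable.exists_rankOne_idempotent`, `I⁻` contains a rank-one idempotent, whose zero extension is a rank-one
idempotent in `𝔊`; `UnitaryTwoOdd.eq_top_of_rankOne` concludes.

WHY IT MATTERS (programme R70). With `UnitaryLeviKernel.exists_rankOne_raise_of_core` this gives
**`UnitaryRankOneRaise.eq_top_of_raise_of_core`**: in the unitary setting with `a < b`, ANY raising operator of rank `ρ`
whose Levi type `(ρ | b − ρ)` is a known core forces `𝔊 = End(W)` — at every rank, not only the maximal one (the Φ-route
of `HodgeThetaSubalgebraUnitaryRaisingRank` needed maximality). The `(8 | 9)` stall of lit-g84 (ranks `3` and `6` are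
the only ones whose Levi types `(3|6)`, `(6|3)` are not cores) is thereby reduced to excluding «all raising ranks in
`{0, 3, 6}`» (sequel file).

## References
* [Ribet1983] K. A. Ribet, *Hodge classes on certain types of abelian varieties*, Amer. J. Math. 105 (1983), Thm. 3
  (= [Gordon1997, Thm. 6.3 (3)], pp. 18–19).
* [Deligne1982HodgeCycles] P. Deligne, *Hodge cycles on abelian varieties*, LNM 900 (1982), I §3 Prop. 3.4, 3.6.
* [GoodmanWallachGTM255] R. Goodman, N. R. Wallach, GTM 255 (2009), §4.1.1.
* [Humphreys1972] J. E. Humphreys, *Introduction to Lie Algebras and Representation Theory*, §19.1, §4.1.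
* [HoffmanKunze1971LinearAlgebra] K. Hoffman, R. Kunze, *Linear Algebra* (1971), §6.7 (projections: trace = rank),
  §3.5–3.6.
-/

noncomputable section

open Module

namespace Literature.AlgebraicGeometry.Motives

namespace HodgeStructure

universe u

variable {W : Type u} [AddCommGroup W] [Module ℂ W]

/-! ### §1 Two bookkeeping lemmas: traces of restricted involutions; Levi kernel ideals of dimension `≥ 2` contain `𝔰𝔩` -/

/-- **Trace of a restricted involution**: if the involution `Θ` preserves `U` and `p ⊆ U` is its `+1`-eigenspace there,
`tr(Θ|_U) = 2·dim p − dim U` (`½(1 + Θ|_U)` is the projection onto `p`; trace of a projection = its rank).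
[cite: HoffmanKunze1971LinearAlgebra, §6.7] -/
theorem UnitaryRankOneRaise.trace_restrict_theta [FiniteDimensional ℂ W] {Θ : Module.End ℂ W} (hΘΘ : Θ * Θ = 1)
    {U : Submodule ℂ W} (hΘU : ∀ x ∈ U, Θ x ∈ U) (p : Submodule ℂ U) (hp : ∀ x : U, x ∈ p ↔ Θ (x : W) = x) :
    LinearMap.trace ℂ U (Θ.restrict hΘU) = 2 * (Module.finrank ℂ p : ℂ) - Module.finrank ℂ U := by
  have hΘΘv : ∀ v, Θ (Θ v) = v := fun v => by rw [← Module.End.mul_apply, hΘΘ, Module.End.one_apply]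
  set Θr : Module.End ℂ U := Θ.restrict hΘU with hΘrdef
  have hΘr : ∀ x : U, ((Θr x : U) : W) = Θ x := fun x => rfl
  set f : Module.End ℂ U := (2 : ℂ)⁻¹ • (1 + Θr) with hfdef
  have hfval : ∀ x : U, ((f x : U) : W) = (2 : ℂ)⁻¹ • ((x : W) + Θ x) := fun x => by
    rw [hfdef, LinearMap.smul_apply, LinearMap.add_apply, Module.End.one_apply, Submodule.coe_smul, Submodule.coe_add,
      hΘr]
  have hproj : LinearMap.IsProj p f := by
    constructor
    · intro x
      rw [hp, hfval, map_smul, map_add, hΘΘv, add_comm]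
    · intro x hx
      apply Subtype.ext
      rw [hfval, (hp x).1 hx]
      module
  have htrf : LinearMap.trace ℂ U f = (Module.finrank ℂ p : ℂ) := hproj.trace
  have hΘf : Θr = (2 : ℂ) • f - 1 := by
    rw [hfdef, smul_smul, mul_inv_cancel₀ (two_ne_zero (α := ℂ)), one_smul]; abel
  rw [hΘf, map_sub, map_smul, htrf, LinearMap.trace_one, smul_eq_mul]

/-- The trace-zero operators of `End(V)` form a subspace of dimension `≥ (dim V)² − 1`, so a subspace containing them
has at least that dimension. [cite: HoffmanKunze1971LinearAlgebra, §3.5] -/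
theorem UnitaryRankOneRaise.finrank_ge_of_traceless_sub {V : Type*} [AddCommGroup V] [Module ℂ V]
    [FiniteDimensional ℂ V] (𝔑 : Submodule ℂ (Module.End ℂ V))
    (h : ∀ T : Module.End ℂ V, LinearMap.trace ℂ V T = 0 → T ∈ 𝔑) :
    Module.finrank ℂ V * Module.finrank ℂ V ≤ Module.finrank ℂ 𝔑 + 1 := by
  have hker : LinearMap.ker (LinearMap.trace ℂ V) ≤ 𝔑 := fun T hT => h T (LinearMap.mem_ker.1 hT)
  have hrange : Module.finrank ℂ (LinearMap.range (LinearMap.trace ℂ V)) ≤ 1 := by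
    have := Submodule.finrank_le (LinearMap.range (LinearMap.trace ℂ V))
    rwa [Module.finrank_self] at this
  have hrn := LinearMap.finrank_range_add_finrank_ker (LinearMap.trace ℂ V)
  rw [Module.finrank_linearMap] at hrn
  have hmono : Module.finrank ℂ (LinearMap.ker (LinearMap.trace ℂ V)) ≤ Module.finrank ℂ 𝔑 :=
    Submodule.finrank_mono hker
  calc Module.finrank ℂ V * Module.finrank ℂ V
      = Module.finrank ℂ (LinearMap.range (LinearMap.trace ℂ V)) +
          Module.finrank ℂ (LinearMap.ker (LinearMap.trace ℂ V)) := hrn.symm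
    _ ≤ 1 + Module.finrank ℂ 𝔑 := add_le_add hrange hmono
    _ = Module.finrank ℂ 𝔑 + 1 := add_comm _ _

/-- **A Levi kernel ideal of dimension `≥ 2` contains every trace-zero operator** (`dim U ≥ 3`; the ideal is
`ad`-stable by `UnitaryLeviKernel.kernel_adStable`, and a subspace of dimension `≥ 2` contains a non-scalar operator).
[cite: Humphreys1972, §19.1] -/
theorem UnitaryRankOneRaise.traceless_sub_of_two_le {V : Type*} [AddCommGroup V] [Module ℂ V]
    [FiniteDimensional ℂ V] (𝔑 : Submodule ℂ (Module.End ℂ V))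
    (had : ∀ A : Module.End ℂ V, ∀ Y ∈ 𝔑, A * Y - Y * A ∈ 𝔑) (h2 : 2 ≤ Module.finrank ℂ 𝔑)
    (h3 : 3 ≤ Module.finrank ℂ V) :
    (∀ T : Module.End ℂ V, LinearMap.trace ℂ V T = 0 → T ∈ 𝔑) ∧
      ∃ N ∈ 𝔑, ∃ w : V, N w ∉ ℂ ∙ w := by
  obtain ⟨N, hN, hNs⟩ := UnitaryAdStable.exists_not_scalar_of_two_le_finrank 𝔑 h2
  obtain ⟨w, hw⟩ := UnitaryAdStable.exists_apply_not_mem_span N hNs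
  exact ⟨UnitaryAdStable.mem_of_trace_eq_zero 𝔑 had hN hw h3, N, hN, w, hw⟩

/-! ### §2 The theorem -/

/-- **A rank-one raising operator forces `𝔊 = End(W)` when `dim P ≠ dim Q` (both `≥ 3`).** See the module docstring
for the proof (double Levi: both Levi algebras of `ι = Θ − 2D₁` are `(m,1)`-cores; Goursat; `𝔰𝔩` inside both Levi
kernel ideals; the element `a·Θ − (a − 2)·ι`; a rank-one idempotent). [cite: Ribet1983, Thm. 3]
[cite: Gordon1997, Thm. 6.3 (3)] [cite: Deligne1982HodgeCycles, I §3 Prop. 3.6] [cite: Humphreys1972, §19.1] -/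
theorem UnitaryRankOneRaise.eq_top_of_rankOne_raise [FiniteDimensional ℂ W] {𝔊 : Submodule ℂ (Module.End ℂ W)}
    (hbr : ∀ Y ∈ 𝔊, ∀ Z ∈ 𝔊, Y * Z - Z * Y ∈ 𝔊)
    (hirr : ∀ U : Submodule ℂ W, (∀ A ∈ 𝔊, ∀ u ∈ U, A u ∈ U) → U = ⊥ ∨ U = ⊤)
    {Θ : Module.End ℂ W} (hΘ : Θ ∈ 𝔊) (hΘΘ : Θ * Θ = 1)
    {P Q : Submodule ℂ W} (hP : ∀ x, x ∈ P ↔ Θ x = x) (hQ : ∀ x, x ∈ Q ↔ Θ x = -x)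
    {s : W → W → ℂ} (hadd : ∀ x y z, s (x + y) z = s x z + s y z) (hsymm : ∀ x y, s y x = starRingEnd ℂ (s x y))
    (hPQ : ∀ p ∈ P, ∀ q ∈ Q, s p q = 0) (hdefP : ∀ p ∈ P, s p p = 0 → p = 0) (hdefQ : ∀ q ∈ Q, s q q = 0 → q = 0)
    (hadj : ∀ X ∈ 𝔊, ∃ Y ∈ 𝔊, ∀ x y, s (X x) y = s x (Y y))
    {B₁ : Module.End ℂ W} (hB₁ : B₁ ∈ 𝔊) (hΘB₁ : Θ * B₁ = B₁) (hB₁Θ : B₁ * Θ = -B₁)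
    (hr1 : Module.finrank ℂ (LinearMap.range B₁) = 1)
    (hab : Module.finrank ℂ P ≠ Module.finrank ℂ Q) (hP3 : 3 ≤ Module.finrank ℂ P) (hQ3 : 3 ≤ Module.finrank ℂ Q) :
    𝔊 = ⊤ := by
  classical
  obtain ⟨haddr, h0r, h0l, hnegr, hnegl, hsubr, hsubl⟩ := UnitaryTwoOdd.herm_right hadd hsymm
  have hΘΘv : ∀ v, Θ (Θ v) = v := fun v => by rw [← Module.End.mul_apply, hΘΘ, Module.End.one_apply]
  obtain ⟨C, hC, ι, hιmem, hBC, hΘC, hCΘ, hιι, hιΘ, hιs, hιa, hιd, hιb, hιc, hmemA, hmemD, hmemB, hmemC, hfinP₀, hfinQ₀,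
    hfinQU, hrangeP, hmapCQ, hfinUm, hfinUp⟩ :=
    UnitaryLeviKernel.exists_involution hbr hΘ hΘΘ hP hQ hadd hsymm hPQ hdefP hdefQ hadj hB₁ hΘB₁ hB₁Θ
  have hιv : ∀ v, ι (ι v) = v := fun v => by rw [← Module.End.mul_apply, hιι, Module.End.one_apply]
  have hιΘv : ∀ w, ι (Θ w) = Θ (ι w) := fun w => by rw [← Module.End.mul_apply, hιΘ, Module.End.mul_apply]
  set a := Module.finrank ℂ P with hadef
  set b := Module.finrank ℂ Q with hbdef
  set Um : Submodule ℂ W := LinearMap.ker (ι + 1) with hUmdef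
  set Up : Submodule ℂ W := LinearMap.ker (ι - 1) with hUpdef
  have hUm : ∀ x, x ∈ Um ↔ ι x = -x := fun x => by
    rw [hUmdef, LinearMap.mem_ker, LinearMap.add_apply, Module.End.one_apply, add_eq_zero_iff_eq_neg]
  have hUp : ∀ x, x ∈ Up ↔ ι x = x := fun x => by
    rw [hUpdef, LinearMap.mem_ker, LinearMap.sub_apply, Module.End.one_apply, sub_eq_zero]
  have hcm : ∀ Z : Module.End ℂ W, Z * ι = ι * Z → ∀ x ∈ Um, Z x ∈ Um := fun Z hZ x hx =>
    (hUm _).2 (by rw [← Module.End.mul_apply, ← hZ, Module.End.mul_apply, (hUm x).1 hx, map_neg])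
  have hcp : ∀ Z : Module.End ℂ W, Z * ι = ι * Z → ∀ x ∈ Up, Z x ∈ Up := fun Z hZ x hx =>
    (hUp _).2 (by rw [← Module.End.mul_apply, ← hZ, Module.End.mul_apply, (hUp x).1 hx])
  -- STEP 1: the Levi algebra on `U⁻` (type `(1 | b − 1)`) is full
  have hPUle : LinearMap.range B₁ ≤ Um := fun x hx => (hUm x).2 (hιa x hx)
  have hQUle : Q ⊓ LinearMap.ker B₁ ≤ Um := fun d hd => (hUm d).2 (hιd d hd)
  have hPUmem : ∀ x ∈ Um, Θ x = x → x ∈ LinearMap.range B₁ := fun x hx hΘx => hmemA x ((hUm x).1 hx) hΘx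
  have hPUΘ : ∀ x ∈ LinearMap.range B₁, Θ x = x := fun x hx => (hP x).1 (hrangeP hx)
  have hQUmem : ∀ x ∈ Um, Θ x = -x → x ∈ Q ⊓ LinearMap.ker B₁ := fun x hx hΘx => hmemD x ((hUm x).1 hx) hΘx
  have hQUΘ : ∀ x ∈ Q ⊓ LinearMap.ker B₁, Θ x = -x := fun x hx => (hQ x).1 (Submodule.mem_inf.1 hx).1
  have hPUQU : ∀ x ∈ LinearMap.range B₁, ∀ y ∈ Q ⊓ LinearMap.ker B₁, s x y = 0 := fun x hx y hy =>
    hPQ x (hrangeP hx) y (Submodule.mem_inf.1 hy).1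
  have hdefPU : ∀ x ∈ LinearMap.range B₁, s x x = 0 → x = 0 := fun x hx h => hdefP x (hrangeP hx) h
  have hdefQU : ∀ y ∈ Q ⊓ LinearMap.ker B₁, s y y = 0 → y = 0 := fun y hy h =>
    hdefQ y (Submodule.mem_inf.1 hy).1 h
  have hfullm := UnitaryThreeCoprime.levi_instance hbr hirr hΘΘ hP hQ hadd hsymm hPQ hdefP hdefQ hadj hιmem hιι hιs hΘ
    hΘΘ hιΘ hUm hPUle hQUle hPUmem hPUΘ hQUmem hQUΘ hPUQU hdefPU hdefQU
    (fun 𝔩 ι' P' Q' hbr𝔩 hirr𝔩 hι' hι'ι' hP' hQ' hfinP' hfinQ' _ _ _ _ =>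
      UnitaryThreeCoprime.eq_top_of_finrank_eq_one hbr𝔩 hirr𝔩 (Submodule.neg_mem _ hι') ((neg_mul_neg ι' ι').trans hι'ι')
        (P := Q') (Q := P') (fun x => by rw [hQ', LinearMap.neg_apply, neg_eq_iff_eq_neg])
        (fun x => by rw [hP', LinearMap.neg_apply, neg_inj]) (by rw [hfinQ']; omega) (by rw [hfinP', hr1]))
  -- STEP 2: the Levi algebra on `U⁺` (type `(a − 1 | 1)`) is full (the involution `−ι`)
  have hnι : -ι ∈ 𝔊 := Submodule.neg_mem _ hιmem
  have hnιι : (-ι) * (-ι) = 1 := by rw [neg_mul_neg, hιι]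
  have hnιs : ∀ x y, s ((-ι) x) y = s x ((-ι) y) := fun x y => by
    rw [LinearMap.neg_apply, LinearMap.neg_apply, hnegl, hnegr, hιs]
  have hnιΘ : (-ι) * Θ = Θ * (-ι) := by rw [neg_mul, mul_neg, hιΘ]
  have hUp' : ∀ x, x ∈ Up ↔ (-ι) x = -x := fun x => by rw [hUp, LinearMap.neg_apply, neg_inj]
  have hPUle' : P ⊓ LinearMap.ker C ≤ Up := fun x hx => (hUp x).2 (hιb x hx)
  have hQUle' : P.map C ≤ Up := fun x hx => (hUp x).2 (hιc x hx)
  have hPUmem' : ∀ x ∈ Up, Θ x = x → x ∈ P ⊓ LinearMap.ker C := fun x hx hΘx => hmemB x ((hUp x).1 hx) hΘx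
  have hPUΘ' : ∀ x ∈ P ⊓ LinearMap.ker C, Θ x = x := fun x hx => (hP x).1 (Submodule.mem_inf.1 hx).1
  have hQUmem' : ∀ x ∈ Up, Θ x = -x → x ∈ P.map C := fun x hx hΘx => hmemC x ((hUp x).1 hx) hΘx
  have hQUΘ' : ∀ x ∈ P.map C, Θ x = -x := fun x hx => (hQ x).1 (hmapCQ hx)
  have hPUQU' : ∀ x ∈ P ⊓ LinearMap.ker C, ∀ y ∈ P.map C, s x y = 0 := fun x hx y hy =>
    hPQ x (Submodule.mem_inf.1 hx).1 y (hmapCQ hy)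
  have hdefPU' : ∀ x ∈ P ⊓ LinearMap.ker C, s x x = 0 → x = 0 := fun x hx h =>
    hdefP x (Submodule.mem_inf.1 hx).1 h
  have hdefQU' : ∀ y ∈ P.map C, s y y = 0 → y = 0 := fun y hy h => hdefQ y (hmapCQ hy) h
  have hfullp' := UnitaryThreeCoprime.levi_instance hbr hirr hΘΘ hP hQ hadd hsymm hPQ hdefP hdefQ hadj hnι hnιι hnιs hΘ
    hΘΘ hnιΘ hUp' hPUle' hQUle' hPUmem' hPUΘ' hQUmem' hQUΘ' hPUQU' hdefPU' hdefQU'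
    (fun 𝔩 ι' P' Q' hbr𝔩 hirr𝔩 hι' hι'ι' hP' hQ' hfinP' hfinQ' _ _ _ _ =>
      UnitaryThreeCoprime.eq_top_of_finrank_eq_one hbr𝔩 hirr𝔩 hι' hι'ι' hP' hQ' (by rw [hfinP']; omega)
        (by rw [hfinQ', hfinQU, hr1]))
  have hfullp : ∀ T : Module.End ℂ Up, ∃ Z ∈ 𝔊, Z * ι = ι * Z ∧ ∀ x : Up, ((T x : Up) : W) = Z x := fun T => by
    obtain ⟨Z, hZ, hZc, hT⟩ := hfullp' T
    exact ⟨Z, hZ, by rw [mul_neg, neg_mul, neg_inj] at hZc; exact hZc, hT⟩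
  -- STEP 3: the Levi kernel ideals both contain `𝔰𝔩`
  obtain ⟨Im, Ip, Lm, Lp, hIm, hIp, hLm, hLp, hdim⟩ := UnitaryLeviKernel.exists_kernel_levi 𝔊 hιι hUm hUp
  obtain ⟨-, hLmfull⟩ := UnitaryLeviKernel.finrank_levi hLm
  obtain ⟨-, hLpfull⟩ := UnitaryLeviKernel.finrank_levi hLp
  have hLmdim := hLmfull hfullm
  have hLpdim := hLpfull hfullp
  rw [hfinUm] at hLmdim
  rw [hfinUp] at hLpdim
  have hadm := UnitaryLeviKernel.kernel_adStable hbr hUp hIm hfullm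
  have hUm' : ∀ x, x ∈ Um ↔ (-ι) x = x := fun x => by rw [hUm, LinearMap.neg_apply, neg_eq_iff_eq_neg]
  have hadp := UnitaryLeviKernel.kernel_adStable hbr hUm' hIp hfullp'
  have h3m : 3 ≤ Module.finrank ℂ Um := by rw [hfinUm]; exact hQ3
  have h3p : 3 ≤ Module.finrank ℂ Up := by rw [hfinUp]; exact hP3
  have hboth : (2 ≤ Module.finrank ℂ Im) ∧ (2 ≤ Module.finrank ℂ Ip) := by
    have h9a : 3 * 3 ≤ a * a := Nat.mul_le_mul hP3 hP3
    have h9b : 3 * 3 ≤ b * b := Nat.mul_le_mul hQ3 hQ3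
    rcases Nat.lt_or_gt_of_ne hab with hlt | hgt
    · -- `a < b`: `I⁻` is big, hence contains `𝔰𝔩`, hence `I⁺` is big too
      have h1 : (a + 1) * (a + 1) ≤ b * b := Nat.mul_le_mul hlt hlt
      have h1' : (a + 1) * (a + 1) = a * a + 2 * a + 1 := by ring
      rw [h1'] at h1
      have h2m : 2 ≤ Module.finrank ℂ Im := by omega
      obtain ⟨htr, -⟩ := UnitaryRankOneRaise.traceless_sub_of_two_le Im hadm h2m h3m
      have hge := UnitaryRankOneRaise.finrank_ge_of_traceless_sub Im htr
      rw [hfinUm] at hge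
      exact ⟨h2m, by omega⟩
    · have h1 : (b + 1) * (b + 1) ≤ a * a := Nat.mul_le_mul hgt hgt
      have h1' : (b + 1) * (b + 1) = b * b + 2 * b + 1 := by ring
      rw [h1'] at h1
      have h2p : 2 ≤ Module.finrank ℂ Ip := by omega
      obtain ⟨htr, -⟩ := UnitaryRankOneRaise.traceless_sub_of_two_le Ip hadp h2p h3p
      have hge := UnitaryRankOneRaise.finrank_ge_of_traceless_sub Ip htr
      rw [hfinUp] at hge
      exact ⟨by omega, h2p⟩
  obtain ⟨htrm, N, hN, w, hw⟩ := UnitaryRankOneRaise.traceless_sub_of_two_le Im hadm hboth.1 h3m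
  obtain ⟨htrp, -⟩ := UnitaryRankOneRaise.traceless_sub_of_two_le Ip hadp hboth.2 h3p
  -- STEP 4: the element `Z₀ = a·Θ − (a − 2)·ι`
  set Z₀ : Module.End ℂ W := (a : ℂ) • Θ - ((a : ℂ) - 2) • ι with hZ₀def
  have hZ₀mem : Z₀ ∈ 𝔊 := Submodule.sub_mem _ (Submodule.smul_mem _ _ hΘ) (Submodule.smul_mem _ _ hιmem)
  have hZ₀c : Z₀ * ι = ι * Z₀ := by
    rw [hZ₀def, sub_mul, mul_sub, smul_mul_assoc, mul_smul_comm, smul_mul_assoc, mul_smul_comm, hιΘ]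
  have hΘm : ∀ x ∈ Um, Θ x ∈ Um := hcm Θ hιΘ.symm
  have hΘp : ∀ x ∈ Up, Θ x ∈ Up := hcp Θ hιΘ.symm
  -- traces on `U⁺`
  set pP : Submodule ℂ Up := (P ⊓ LinearMap.ker C).comap Up.subtype with hpPdef
  have hpP : ∀ x : Up, x ∈ pP ↔ Θ (x : W) = x := fun x => by
    rw [hpPdef, Submodule.mem_comap, Submodule.subtype_apply]
    exact ⟨fun h => hPUΘ' _ h, fun h => hPUmem' _ x.2 h⟩
  have hfinpP : Module.finrank ℂ pP = Module.finrank ℂ ↥(P ⊓ LinearMap.ker C) := by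
    rw [hpPdef, (Submodule.comapSubtypeEquivOfLe hPUle').finrank_eq]
  have htrΘp : LinearMap.trace ℂ Up (Θ.restrict hΘp) = 2 * (Module.finrank ℂ pP : ℂ) - Module.finrank ℂ Up :=
    UnitaryRankOneRaise.trace_restrict_theta hΘΘ hΘp pP hpP
  have hιp_one : ι.restrict (hcp ι rfl) = (1 : Module.End ℂ Up) :=
    LinearMap.ext fun x => Subtype.ext (by rw [LinearMap.restrict_apply, Module.End.one_apply]; exact (hUp _).1 x.2)
  have hZ₀p : Z₀.restrict (hcp Z₀ hZ₀c) = (a : ℂ) • Θ.restrict hΘp - ((a : ℂ) - 2) • ι.restrict (hcp ι rfl) :=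
    LinearMap.ext fun x => Subtype.ext (by
      simp only [LinearMap.restrict_apply, LinearMap.sub_apply, LinearMap.smul_apply, Submodule.coe_sub,
        Submodule.coe_smul, hZ₀def])
  have htrp0 : LinearMap.trace ℂ Up (Z₀.restrict (hcp Z₀ hZ₀c)) = 0 := by
    rw [hZ₀p, map_sub, map_smul, map_smul, htrΘp, hιp_one, LinearMap.trace_one, hfinpP, hfinUp, smul_eq_mul,
      smul_eq_mul]
    have h : (Module.finrank ℂ ↥(P ⊓ LinearMap.ker C) : ℂ) = (a : ℂ) - 1 := by
      have : Module.finrank ℂ ↥(P ⊓ LinearMap.ker C) + 1 = a := by rw [← hfinP₀, hr1, add_comm]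
      rw [← this]; push_cast; ring
    rw [h]; ring
  -- traces on `U⁻`
  set pM : Submodule ℂ Um := (LinearMap.range B₁).comap Um.subtype with hpMdef
  have hpM : ∀ x : Um, x ∈ pM ↔ Θ (x : W) = x := fun x => by
    rw [hpMdef, Submodule.mem_comap, Submodule.subtype_apply]
    exact ⟨fun h => hPUΘ _ h, fun h => hPUmem _ x.2 h⟩
  have hfinpM : Module.finrank ℂ pM = 1 := by
    rw [hpMdef, (Submodule.comapSubtypeEquivOfLe hPUle).finrank_eq, hr1]
  have htrΘm : LinearMap.trace ℂ Um (Θ.restrict hΘm) = 2 * (Module.finrank ℂ pM : ℂ) - Module.finrank ℂ Um :=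
    UnitaryRankOneRaise.trace_restrict_theta hΘΘ hΘm pM hpM
  have hιm_neg : ι.restrict (hcm ι rfl) = (-1 : Module.End ℂ Um) :=
    LinearMap.ext fun x => Subtype.ext (by
      rw [LinearMap.restrict_apply, LinearMap.neg_apply, Module.End.one_apply, Submodule.coe_neg]; exact (hUm _).1 x.2)
  have hZ₀m : Z₀.restrict (hcm Z₀ hZ₀c) = (a : ℂ) • Θ.restrict hΘm - ((a : ℂ) - 2) • ι.restrict (hcm ι rfl) :=
    LinearMap.ext fun x => Subtype.ext (by
      simp only [LinearMap.restrict_apply, LinearMap.sub_apply, LinearMap.smul_apply, Submodule.coe_sub,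
        Submodule.coe_smul, hZ₀def])
  have htrm : LinearMap.trace ℂ Um (Z₀.restrict (hcm Z₀ hZ₀c)) = 2 * ((a : ℂ) - b) := by
    rw [hZ₀m, map_sub, map_smul, map_smul, htrΘm, hιm_neg, map_neg, LinearMap.trace_one, hfinpM, hfinUm, smul_eq_mul,
      smul_eq_mul]
    push_cast; ring
  have htrm0 : LinearMap.trace ℂ Um (Z₀.restrict (hcm Z₀ hZ₀c)) ≠ 0 := by
    rw [htrm]
    refine mul_ne_zero two_ne_zero (sub_ne_zero.2 ?_)
    exact_mod_cast hab
  -- STEP 5: `Z₀|_{U⁺} ∈ I⁺`, so `Z₀ − K` kills `U⁺` and `Z₀|_{U⁻} ∈ I⁻` has non-zero trace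
  obtain ⟨K, hK, hKval, hK0⟩ := (hIp _).1 (htrp _ htrp0)
  have hTm : Z₀.restrict (hcm Z₀ hZ₀c) ∈ Im := by
    refine (hIm _).2 ⟨Z₀ - K, Submodule.sub_mem _ hZ₀mem hK, fun x => ?_, fun y hy => ?_⟩
    · rw [LinearMap.sub_apply, hK0 _ x.2, sub_zero]; rfl
    · have h := hKval ⟨y, hy⟩
      rw [LinearMap.restrict_apply] at h
      rw [LinearMap.sub_apply, ← h, sub_self]
  obtain ⟨u, φ, hφu, hmem⟩ := UnitaryAdStable.exists_rankOne_idempotent Im hadm hN hw h3m hTm htrm0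
  -- STEP 6: the zero extension of the rank-one idempotent `u ⊗ φ` lies in `𝔊`
  obtain ⟨Z₁, hZ₁, hZ₁val, hZ₁0⟩ := (hIm _).1 hmem
  have hmm : ∀ y, ((2 : ℂ)⁻¹ • (1 - ι)) y ∈ Um := fun y => (hUm _).2 (by
    simp only [LinearMap.smul_apply, LinearMap.sub_apply, Module.End.one_apply, map_smul, map_sub, hιv]
    module)
  set πm : W →ₗ[ℂ] Um := LinearMap.codRestrict Um ((2 : ℂ)⁻¹ • (1 - ι)) hmm with hπmdef
  have hπmval : ∀ y, (πm y : W) = (2 : ℂ)⁻¹ • (y - ι y) := fun y => by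
    rw [hπmdef, LinearMap.codRestrict_apply, LinearMap.smul_apply, LinearMap.sub_apply, Module.End.one_apply]
  have hπm_id : ∀ x : Um, πm x = x := fun x => Subtype.ext (by rw [hπmval, (hUm x).1 x.2]; module)
  have hp_mem : ∀ y, (2 : ℂ)⁻¹ • (y + ι y) ∈ Up := fun y => (hUp _).2 (by rw [map_smul, map_add, hιv, add_comm])
  set φ' : Module.Dual ℂ W := φ ∘ₗ πm with hφ'def
  have hZ₁eq : Z₁ = φ'.smulRight (u : W) := by
    refine LinearMap.ext fun y => ?_
    have hy : y = (πm y : W) + (2 : ℂ)⁻¹ • (y + ι y) := by rw [hπmval]; module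
    rw [LinearMap.smulRight_apply, hφ'def, LinearMap.comp_apply]
    conv_lhs => rw [hy, map_add, hZ₁0 _ (hp_mem y), add_zero, ← hZ₁val (πm y)]
    rw [LinearMap.smulRight_apply, Submodule.coe_smul]
  have hφ'u : φ' (u : W) = 1 := by rw [hφ'def, LinearMap.comp_apply, hπm_id, hφu]
  exact UnitaryTwoOdd.eq_top_of_rankOne hbr hirr hφ'u (hZ₁eq ▸ hZ₁)

end HodgeStructure

end Literature.AlgebraicGeometry.Motives
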